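import Literature.AlgebraicGeometry.AbelianSchemes.ExistsAmpleOfMultipliedIdentity
import Literature.AlgebraicGeometry.AbelianSchemes.AbelianSchemeQuotientIsLambdaOfAtSq
import Literature.AlgebraicGeometry.AbelianSchemes.AbelianSchemeQuotientPolarizationPullbackDesc
import Literature.AlgebraicGeometry.AbelianSchemes.PolarizationSymmetricWitnessOfOnto
import Literature.AlgebraicGeometry.AbelianSchemes.PolarizationUnitHypothesis
import Literature.AlgebraicGeometry.AbelianSchemes.FibreHomPointsOfFibrePoints
import Literature.AlgebraicGeometry.AbelianSchemes.AbelianSchemeOverMulNEtale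
import Literature.AlgebraicGeometry.Motives.AbelianVarietySimpleOfIsogenyAnyField
import HarnessLib

/-!
# `exists_ample` for the descended polarisation `λ_B` of the quotient `B = A/K`: the `Polarization` RECORD of `(A/K, D_B)`

Layer `Literature/AlgebraicGeometry/AbelianSchemes`, namespace `Literature.AlgebraicGeometry.AbelianSchemes.AbelianSchemeOver`.
THEOREMS ONLY (no definition, no named fact, no instance, no `sorry`).  Cell `hodgecm-mathlib` (D-0151), Hecke-link socket (B),
(X-amp) plan of record — the LAST wrapper ((X-amp@Q-W), B-plan1 (g15) 23:43:14Z): the `polB`/`hpolB` input of the quotient-triple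
builder ★ `exists_quotientTriple_of_fields` (`HeckeQuotientTriple`), i.e. a polarisation STRUCTURE of `(A/K, D_B)` ([MumfordFogartyKirwan1994]
Def. 6.3: at every geometric point `λ̄_B = Λ(𝒪(Θ))` for an AMPLE `Θ`) whose morphism is the descended `λ_B := polarizationDesc λ` (★).

At a geometric point `s : Spec Ω → S` (`Ω` algebraically closed, `n` and `2` nonzero in `Ω`) the ample witness comes from ★ B-p15
`exists_isAmple_isLambdaOfAt_of_mulN_comp_eq_sq` ([MumfordAV1970] §23 Thm. 2, §8) fed, with NO new hypothesis, by:
`π := π_d = mulNDesc` (★, `ψ ≫ π_d = [d]_A`, `π_d ≫ ψ = [d]_B`), so that `π_s` is finite (hence affine) and surjective (hence dominant)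
by the two fibre identities and «`[d]` is an isogeny» (★ `isIsogeny_zsmul_id_holds`, ★ `isFinite_of_isFinite_comp` /
`surjective_of_surjective_comp`); the multiplied identity (b′) `[n]_B ≫ (π_d ≫ λ ≫ π_d^∨) = λ_B ≫ [d²]_{B̂}` (★ B-p14
`mulN_comp_mulNDesc_comp_comp_dualIsogenyOver`); the unit hypothesis `hD_B` of the quotient dual pair (★ B-p05
`nonempty_unitHatSlice_dualPairOfQuotientRigidified_iso` from `hD` = ★ `Polarization.nonempty_unitHatSlice_iso`); `π_d^∨` a homomorphism
(★ `isMonHom_dualIsogenyOver`); a SYMMETRIC ample witness `Θ′` of `λ̄` upstairs (★ (h1) `exists_isAmple_isLambdaOfAt_symmetric_of_onto`,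
from `λ` onto on geometric fibre points = the standard `hsurj` binder); and the symmetric witness `E₄` of `λ̄_B⁴` (★ B-p05
`exists_symmetric_isLambdaOfAt_polarizationDesc_pow_four`, with `ψ_s` onto on `Ω`-points from ★ `quotientBy_ontoFibres`).

* `exists_isAmple_isLambdaOfAt_polarizationDesc` — (W1) the `exists_ample` clause of `λ_B` at ONE geometric point;
* **`exists_polarization_lam_eq_polarizationDesc`** — (W2) `∃ polB : (A/K).Polarization D_B, polB.lam = polarizationDesc λ`, under
  «`n ≠ 0` and `2 ≠ 0` in every residue field of `S`» (★ `[N]`-package currency) and `hsurj`;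
* `exists_polarization_lam_eq_polarizationDesc_of_charZero` / `…_of_charZero_of_odd` — the same over a base `S → Spec F`, `char F = 0`
  (and `d := n` odd: the Hecke instance `n = d = N′/N`).

HC_CM is proved only modulo the 7 printed citations until rung 0 closes; nothing here is about HC.

## References
* [MumfordAV1970] D. Mumford, *Abelian Varieties* (1970), §23 Thm. 2–3 (p. 231), §8 (pp. 74–77), §7 Thm. 4 (p. 72), §15 Thm. 1 (p. 143).
* [MumfordFogartyKirwan1994] D. Mumford, J. Fogarty, F. Kirwan, *Geometric Invariant Theory*, 3rd ed. (1994), Ch. 6 §2 Definition 6.3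
  and Prop. 6.10 (pp. 120–121); Ch. 7 §3 (p. 139).
-/

noncomputable section

universe u

open CategoryTheory CategoryTheory.Limits AlgebraicGeometry MonoidalCategory CartesianMonoidalCategory
open scoped MonObj

namespace Literature.AlgebraicGeometry.AbelianSchemes

namespace AbelianSchemeOver

open Literature.AlgebraicGeometry.RelativeSpec Literature.AlgebraicGeometry.AbelianVarieties
  Literature.AlgebraicGeometry.Motives Literature.AlgebraicGeometry.Modules

/-! ## §0 Two fibre lemmas: `π_s` is affine and dominant when `ψ_s ≫ π_s` and `π_s ≫ ψ_s` are multiplication by `d ≠ 0` -/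

section Fibre

variable {S : Scheme.{u}} {B A' : AbelianSchemeOver S} (π : B.X ⟶ A'.X) [IsMonHom π] (ψ : A'.X ⟶ B.X) [IsMonHom ψ]
  {Ω : Type u} [Field Ω] (s : Spec (.of Ω) ⟶ S) {d : ℕ}

/-- The underlying `Ω`-morphism of the fibre homomorphism `(f ≫ g)_s` for `f ≫ g = [d]` is that of `[d]` of the fibre
ABELIAN VARIETY (the base-change functor is monoidal, ★ `map_id_pow'`; ★ `AbelianVariety.hom_zsmul_id`). [cite: MumfordAV1970, §7 Thm. 4 (p. 72)] -/
theorem toSchemeHom_fibreHom_comp_fibreHom_of_comp_eq_mulN (h : π ≫ ψ = B.mulN d) :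
    AbelianVariety.Hom.toSchemeHom (fibreHom π s ≫ fibreHom ψ s) =
      AbelianVariety.Hom.toSchemeHom ((d : ℤ) • 𝟙 (B.fibre s).toAbelianVariety) := by
  have e1 : AbelianVariety.Hom.toSchemeHom ((d : ℤ) • 𝟙 (B.fibre s).toAbelianVariety) =
      ((Over.pullback s).map ((𝟙 B.X : B.X ⟶ B.X) ^ d)).left := by
    change ((((d : ℤ) • 𝟙 (B.fibre s).toAbelianVariety).hom.hom.hom)).left = _
    rw [AbelianVariety.hom_zsmul_id, zpow_natCast, map_id_pow']
    rfl
  rw [e1]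
  change ((Over.pullback s).map π ≫ (Over.pullback s).map ψ).left = _
  rw [← Functor.map_comp, h, mulN_def]

/-- **`π_s` is FINITE, hence affine, when `π ≫ ψ = [d]_B` with `d ≠ 0`** (`[d]` of the fibre is an isogeny over any field, ★
`isIsogeny_zsmul_id_holds`; finite morphisms cancel against separated ones, ★ `isFinite_of_isFinite_comp`).
[cite: MumfordAV1970, §7 Thm. 4 (p. 72)] [cite: MumfordFogartyKirwan1994, Ch. 6 §2 Prop. 6.10 (p. 121)] -/
theorem isAffineHom_toSchemeHom_fibreHom_of_comp_eq_mulN (hd : d ≠ 0) (h : π ≫ ψ = B.mulN d) :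
    IsAffineHom (AbelianVariety.Hom.toSchemeHom (fibreHom π s)) := by
  have hiso := AbelianVariety.isIsogeny_zsmul_id_holds (B.fibre s).toAbelianVariety (d : ℤ) (by exact_mod_cast hd)
  haveI : IsFinite (AbelianVariety.Hom.toSchemeHom (fibreHom π s ≫ fibreHom ψ s)) := by
    rw [toSchemeHom_fibreHom_comp_fibreHom_of_comp_eq_mulN π ψ s h]; exact hiso.2
  haveI := AbelianVariety.isFinite_of_isFinite_comp (fibreHom π s) (fibreHom ψ s)
  infer_instance

/-- **`π_s` is SURJECTIVE, hence dominant, when `ψ ≫ π = [d]_{A′}` with `d ≠ 0`** (★ `surjective_of_surjective_comp`).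
[cite: MumfordAV1970, §7 Thm. 4 (p. 72)] [cite: MumfordFogartyKirwan1994, Ch. 6 §2 Prop. 6.10 (p. 121)] -/
theorem isDominant_toSchemeHom_fibreHom_of_comp_eq_mulN (hd : d ≠ 0) (h : ψ ≫ π = A'.mulN d) :
    IsDominant (AbelianVariety.Hom.toSchemeHom (fibreHom π s)) := by
  have hiso := AbelianVariety.isIsogeny_zsmul_id_holds (A'.fibre s).toAbelianVariety (d : ℤ) (by exact_mod_cast hd)
  haveI : Surjective (AbelianVariety.Hom.toSchemeHom (fibreHom ψ s ≫ fibreHom π s)) := by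
    rw [toSchemeHom_fibreHom_comp_fibreHom_of_comp_eq_mulN ψ π s h]; exact hiso.1
  haveI := AbelianVariety.surjective_of_surjective_comp (fibreHom ψ s) (fibreHom π s)
  infer_instance

end Fibre

/-! ## §1 The quotient data (VERBATIM the (ii)-chain block of ★ `AbelianSchemeQuotientIsLambdaOfAtSq` / ★ `HeckeQuotientTriple`) -/

variable {S : Scheme.{u}} [IsReduced S] [IsLocallyNoetherian S] (A : AbelianSchemeOver S)
  {Y : Scheme.{u}} (u : S ⟶ Y) (K : Subgroup A.Sections) [IsCommMonObj A.X] {n : ℕ}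
  (hK : ∀ σ : K, (σ : A.Sections) ^ n = 1)
  [Finite K] [Y.IsSeparated] [IsSeparated (A.X.hom ≫ u)] [S.IsSeparated]
  (hcov : ∀ x : A.left, ∃ O : (A.translationActionOver u K).StableAffineOpens, x ∈ O.1)
  [LocallyOfFiniteType (A.X.hom ≫ u)] [IsLocallyNoetherian Y]
  (hG : ∃ _ : GrpObj (A.quotientOver u K), IsMonHom (A.quotientMk u K hcov))
  (hsm : Smooth (A.quotientOver u K).hom) (hgc : GeometricallyConnected (A.quotientOver u K).hom)
  (D : A.DualPair) [IsAffine Y]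
  (hfree : ∀ (Ω : Type u) [Field Ω] [IsAlgClosed Ω] (x : Spec (.of Ω) ⟶ A.left) (σ : K), σ ≠ 1 →
    x ≫ (A.translation (σ : A.Sections)).left ≠ x)
  (K' : Subgroup D.hat.Sections) [Finite K'] [IsSeparated (D.hat.X.hom ≫ u)]
  (hcov' : ∀ x : D.hat.left, ∃ O : (D.hat.translationActionOver u K').StableAffineOpens, x ∈ O.1)
  [LocallyOfFiniteType (D.hat.X.hom ≫ u)]
  (hG' : ∃ _ : GrpObj (D.hat.quotientOver u K'), IsMonHom (D.hat.quotientMk u K' hcov'))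
  (hsm' : Smooth (D.hat.quotientOver u K').hom) (hgc' : GeometricallyConnected (D.hat.quotientOver u K').hom)
  (hfree' : ∀ (Ω : Type u) [Field Ω] [IsAlgClosed Ω] (x : Spec (.of Ω) ⟶ D.hat.left) (σ : K'), σ ≠ 1 →
    x ≫ (D.hat.translation (σ : D.hat.Sections)).left ≠ x)
  (Φ : (prodTranslationActionOver (A.quotientBy u K hcov hG hsm hgc) D.hat u K' hcov').EquivariantStructure
    (A.poincarePullback u K hK hcov hG hsm hgc D hfree))
  (h4 : ∀ {T : Scheme.{u}} (f : T ⟶ S) (ℒ : (A.quotientBy u K hcov hG hsm hgc).RigidifiedLineBundle f),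
    ℒ.FibrewisePicZero →
    ∃! g : {g : T ⟶ (D.hat.quotientBy u K' hcov' hG' hsm' hgc').X.left //
        g ≫ (D.hat.quotientBy u K' hcov' hG' hsm' hgc').X.hom = f},
      Nonempty ((Scheme.Modules.pullback ((A.quotientBy u K hcov hG hsm hgc).baseChangeToProd
        (D.hat.quotientBy u K' hcov' hG' hsm' hgc') f g.1 g.2)).obj
          (A.poincareQuotRigid u K hK hcov hG hsm hgc D hfree K' hcov' hG' hsm' hgc' Φ) ≅ ℒ.L))
  (pol : A.Polarization D)
  (hlam : ∀ σ : K, A.translation (σ : A.Sections) ≫ pol.lam ≫ D.hat.quotientMk u K' hcov' =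
    pol.lam ≫ D.hat.quotientMk u K' hcov')

/-! ## §2 (W1) `exists_ample` of `λ_B` at one geometric point -/

include hfree hfree' in
/-- **(W1) `λ̄_B = Λ(𝒪(Θ))` FOR AN AMPLE `Θ`, AT A GEOMETRIC POINT `s`** of the reduced locally Noetherian base (`Ω` algebraically
closed with `n ≠ 0` and `2 ≠ 0` in `Ω`; `K ⊆ A[n] ∩ A[d]`, `d` odd; `λ` onto on geometric fibre points over `s`): the descended
polarisation `λ_B = polarizationDesc λ` of `B = A/K` towards the quotient dual pair `D_B = dualPairOfQuotientRigidified …` has an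
ample `Λ`-witness on `B_s` — ★ `exists_isAmple_isLambdaOfAt_of_mulN_comp_eq_sq` at `π := π_d` with every input discharged by name
(module docstring). [cite: MumfordAV1970, §23 Thm. 2 (p. 231) and §8 (pp. 74–75)] [cite: MumfordFogartyKirwan1994, Ch. 6 §2 Definition 6.3 and Prop. 6.10 (pp. 120–121)] -/
theorem exists_isAmple_isLambdaOfAt_polarizationDesc {d : ℕ} (hKd : ∀ σ : K, (σ : A.Sections) ^ d = 1) (hd : Odd d)
    {Ω : Type u} [Field Ω] [IsAlgClosed Ω] (s : Spec (.of Ω) ⟶ S) (hn : (n : Ω) ≠ 0) (h2 : (2 : Ω) ≠ 0)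
    (hsurj : ∀ y : D.hat.FibrePoints s, ∃ x : A.FibrePoints s, x ≫ pol.lam = y) :
    ∃ Θ : CartierDivisor ((A.quotientBy u K hcov hG hsm hgc).fibre s).toAbelianVariety.X.left, Θ.IsAmple ∧
      (A.quotientBy u K hcov hG hsm hgc).IsLambdaOfAt s
        (A.dualPairOfQuotientRigidified u K hK hcov hG hsm hgc D hfree K' hcov' hG' hsm' hgc' hfree' Φ h4)
        (A.polarizationDesc u K hcov D.hat K' hcov' pol.lam hlam) Θ := by
  letI : GrpObj (A.quotientOver u K) := (A.quotientBy u K hcov hG hsm hgc).grpObj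
  letI : GrpObj (D.hat.quotientOver u K') := (D.hat.quotientBy u K' hcov' hG' hsm' hgc').grpObj
  haveI hψ := A.isMonHom_quotientMk u K hcov hG hsm hgc
  haveI := D.hat.isMonHom_quotientMk u K' hcov' hG' hsm' hgc'
  haveI := pol.isMonHom
  haveI hπ := A.isMonHom_mulNDesc u K hKd hcov hG hsm hgc hfree
  haveI hlamB := A.isMonHom_polarizationDesc u K hcov hG hsm hgc hfree D.hat K' hcov' hG' hsm' hgc' pol.lam hlam
  have hd0 : d ≠ 0 := by rintro rfl; exact Nat.not_odd_zero hd
  have hn0 : 0 < n := Nat.pos_of_ne_zero (by rintro rfl; exact hn Nat.cast_zero)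
  -- the unit hypotheses `hD` (upstairs) and `hD_B` (quotient dual pair)
  have hD := pol.nonempty_unitHatSlice_iso
  have hDB := A.nonempty_unitHatSlice_dualPairOfQuotientRigidified_iso u K hK hcov hG hsm hgc D hfree K' hcov' hG' hsm'
    hgc' hfree' Φ h4 hD
  -- the homomorphisms `ψ`, `π_d`, `λ_B`, keyed on the objects `(A/K).X`, `A.X`, `D_B.hat.X` the consumers' binders carry
  haveI hψ' : @IsMonHom _ _ _ A.X (A.quotientBy u K hcov hG hsm hgc).X _ _ (A.quotientMk u K hcov) := hψ
  haveI hπ' : @IsMonHom _ _ _ (A.quotientBy u K hcov hG hsm hgc).X A.X _ _ (A.mulNDesc u K hKd hcov) := hπ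
  haveI hlamB' : @IsMonHom _ _ _ (A.quotientBy u K hcov hG hsm hgc).X
      (A.dualPairOfQuotientRigidified u K hK hcov hG hsm hgc D hfree K' hcov' hG' hsm' hgc' hfree' Φ h4).hat.X _ _
      (A.polarizationDesc u K hcov D.hat K' hcov' pol.lam hlam) := hlamB
  -- the fibre `(π_d)_s` is affine and dominant (`ψ ≫ π_d = [d]`, `π_d ≫ ψ = [d]`, `d ≠ 0`)
  haveI := isAffineHom_toSchemeHom_fibreHom_of_comp_eq_mulN (B := A.quotientBy u K hcov hG hsm hgc) (A' := A)
    (A.mulNDesc u K hKd hcov) (A.quotientMk u K hcov) s hd0 (A.mulNDesc_comp_quotientMk u K hKd hcov hG hsm hgc hfree)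
  haveI := isDominant_toSchemeHom_fibreHom_of_comp_eq_mulN (B := A.quotientBy u K hcov hG hsm hgc) (A' := A)
    (A.mulNDesc u K hKd hcov) (A.quotientMk u K hcov) s hd0 (A.quotientMk_comp_mulNDesc u K hKd hcov)
  -- `π_d^∨` is a homomorphism (reduced base)
  haveI := DualPair.isMonHom_dualIsogenyOver (A' := A.quotientBy u K hcov hG hsm hgc) (B := A)
    (A.mulNDesc u K hKd hcov) (A.dualPairOfQuotientRigidified u K hK hcov hG hsm hgc D hfree K' hcov' hG' hsm' hgc' hfree' Φ h4)
    D hD hDB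
  -- `λ_B ^ 4` is a homomorphism: `B̂ = Â/K′` is commutative over the reduced base
  haveI : IsCommMonObj (A.dualPairOfQuotientRigidified u K hK hcov hG hsm hgc D hfree K' hcov' hG' hsm' hgc' hfree' Φ h4).hat.X :=
    (A.dualPairOfQuotientRigidified u K hK hcov hG hsm hgc D hfree K' hcov' hG' hsm' hgc' hfree' Φ h4).hat.isCommMonObj_of_isReduced_base
  haveI : IsMonHom ((show (A.quotientBy u K hcov hG hsm hgc).X ⟶
      (A.dualPairOfQuotientRigidified u K hK hcov hG hsm hgc D hfree K' hcov' hG' hsm' hgc' hfree' Φ h4).hat.X from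
        A.polarizationDesc u K hcov D.hat K' hcov' pol.lam hlam) ^ 4) := by
    have h2m : IsMonHom ((show (A.quotientBy u K hcov hG hsm hgc).X ⟶
        (A.dualPairOfQuotientRigidified u K hK hcov hG hsm hgc D hfree K' hcov' hG' hsm' hgc' hfree' Φ h4).hat.X from
          A.polarizationDesc u K hcov D.hat K' hcov' pol.lam hlam) ^ 2) := by
      rw [pow_two]
      exact (A.dualPairOfQuotientRigidified u K hK hcov hG hsm hgc D hfree K' hcov' hG' hsm' hgc' hfree' Φ h4).hat.isMonHom_mul _ _
    have h3m : IsMonHom ((show (A.quotientBy u K hcov hG hsm hgc).X ⟶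
        (A.dualPairOfQuotientRigidified u K hK hcov hG hsm hgc D hfree K' hcov' hG' hsm' hgc' hfree' Φ h4).hat.X from
          A.polarizationDesc u K hcov D.hat K' hcov' pol.lam hlam) ^ 3) := by
      rw [pow_succ]
      exact (A.dualPairOfQuotientRigidified u K hK hcov hG hsm hgc D hfree K' hcov' hG' hsm' hgc' hfree' Φ h4).hat.isMonHom_mul _ _
    rw [pow_succ]
    exact (A.dualPairOfQuotientRigidified u K hK hcov hG hsm hgc D hfree K' hcov' hG' hsm' hgc' hfree' Φ h4).hat.isMonHom_mul _ _
  -- the multiplied identity (b′) `[n]_B ≫ (π_d ≫ λ ≫ π_d^∨) = λ_B ≫ [d²]`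
  have hmul := A.mulN_comp_mulNDesc_comp_comp_dualIsogenyOver u K hK hcov hG hsm hgc D hfree K' hcov' hG' hsm' hgc' hfree' Φ
    pol.lam hlam h4 hD hDB hKd
  rw [← pow_two] at hmul
  -- a symmetric ample witness `Θ′` of `λ̄` upstairs, and the symmetric witness `E₄` of `λ̄_B⁴`
  obtain ⟨Θ', hΘ'amp, hΘ', hΘ'sym⟩ := pol.exists_isAmple_isLambdaOfAt_symmetric_of_onto A s h2 hsurj
  have hψs := surjective_map_fibreHom_of_forall_fibrePoints (A := A) (B := A.quotientBy u K hcov hG hsm hgc) s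
    (A.quotientMk u K hcov) (A.quotientBy_ontoFibres u K hcov hG hsm hgc s)
  obtain ⟨E₄, hE₄, hE₄sym⟩ := A.exists_symmetric_isLambdaOfAt_polarizationDesc_pow_four u K hK hcov hG hsm hgc D hfree K'
    hcov' hG' hsm' hgc' hfree' Φ h4 pol.lam hlam hD s hn hΘ' hψs
  exact exists_isAmple_isLambdaOfAt_of_mulN_comp_eq_sq (B := A.quotientBy u K hcov hG hsm hgc) (A' := A)
    (A.mulNDesc u K hKd hcov) (A.dualPairOfQuotientRigidified u K hK hcov hG hsm hgc D hfree K' hcov' hG' hsm' hgc' hfree' Φ h4)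
    D s hDB hn0 hd hmul hΘ'amp hΘ' hΘ'sym hE₄ hE₄sym

/-! ## §3 (W2) The `Polarization` record of `(A/K, D_B)` with `lam = λ_B` -/

include hfree hfree' in
/-- **(W2) THE DESCENDED POLARISATION AS A `Polarization` RECORD**: if `n ≠ 0` and `2 ≠ 0` in every residue field of `S`
(`K ⊆ A[n] ∩ A[d]`, `d` odd) and `λ` is onto on geometric fibre points (the `hsurj` binder of ★ `PolarizationHatLevelStructure`,
discharged for typed triples by ★ `exists_comp_lam_eq_baseChange_of_locallyOfFiniteType`), then there is a polarisation structure
`polB` of `(A/K, D_B)` in the sense of [MFK] Def. 6.3 with `polB.lam = polarizationDesc λ` — the `(polB) (hpolB)` input of ★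
`exists_quotientTriple_of_fields`. [cite: MumfordFogartyKirwan1994, Ch. 6 §2 Definition 6.3 (p. 120) and Ch. 7 §3 (p. 139)]
[cite: MumfordAV1970, §23 Thm. 2 (p. 231)] -/
theorem exists_polarization_lam_eq_polarizationDesc {d : ℕ} (hKd : ∀ σ : K, (σ : A.Sections) ^ d = 1) (hd : Odd d)
    (hnS : ∀ s : S, (n : S.residueField s) ≠ 0) (h2S : ∀ s : S, (2 : S.residueField s) ≠ 0)
    (hsurj : ∀ ⦃Ω : Type u⦄ [Field Ω] [IsAlgClosed Ω] (s : Spec (.of Ω) ⟶ S) (y : D.hat.FibrePoints s),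
      ∃ x : A.FibrePoints s, x ≫ pol.lam = y) :
    ∃ polB : (A.quotientBy u K hcov hG hsm hgc).Polarization
        (A.dualPairOfQuotientRigidified u K hK hcov hG hsm hgc D hfree K' hcov' hG' hsm' hgc' hfree' Φ h4),
      polB.lam = A.polarizationDesc u K hcov D.hat K' hcov' pol.lam hlam := by
  letI : GrpObj (A.quotientOver u K) := (A.quotientBy u K hcov hG hsm hgc).grpObj
  letI : GrpObj (D.hat.quotientOver u K') := (D.hat.quotientBy u K' hcov' hG' hsm' hgc').grpObj
  haveI := pol.isMonHom
  haveI hlamB := A.isMonHom_polarizationDesc u K hcov hG hsm hgc hfree D.hat K' hcov' hG' hsm' hgc' pol.lam hlam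
  have h2S' : ∀ x : S, ((2 : ℕ) : S.residueField x) ≠ 0 := fun x => by exact_mod_cast h2S x
  exact ⟨{ lam := A.polarizationDesc u K hcov D.hat K' hcov' pol.lam hlam
           isMonHom := hlamB
           exists_ample := fun Ω _ _ s =>
             A.exists_isAmple_isLambdaOfAt_polarizationDesc u K hK hcov hG hsm hgc D hfree K' hcov' hG' hsm' hgc' hfree' Φ h4
               pol hlam hKd hd s (natCast_ne_zero_of_specMap s (hnS _))
               (by exact_mod_cast (natCast_ne_zero_of_specMap s (h2S' _) : ((2 : ℕ) : Ω) ≠ 0)) (hsurj s) }, rfl⟩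

omit [IsReduced S] [IsLocallyNoetherian S] [S.IsSeparated] in
/-- Over a field of characteristic zero every nonzero natural number is nonzero in the field of a geometric point (private helper).
[folklore] -/
private theorem natCast_ne_zero_of_charZero_base {F : Type u} [Field F] [CharZero F] (f : S ⟶ Spec (.of F)) {Ω : Type u}
    [Field Ω] (s : Spec (.of Ω) ⟶ S) {m : ℕ} (hm : m ≠ 0) : (m : Ω) ≠ 0 := by
  let φ : F →+* Ω := (Spec.preimage (s ≫ f)).hom
  rw [← map_natCast φ m]
  exact (map_ne_zero φ).mpr (Nat.cast_ne_zero.mpr hm)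

include hfree hfree' in
/-- **(W2′) The same over a base of CHARACTERISTIC ZERO** (`S → Spec F`, `char F = 0`; `n ≠ 0`, `d` odd).
[cite: MumfordFogartyKirwan1994, Ch. 6 §2 Definition 6.3 (p. 120) and Ch. 7 §3 (p. 139)] [cite: MumfordAV1970, §23 Thm. 2 (p. 231)] -/
theorem exists_polarization_lam_eq_polarizationDesc_of_charZero {F : Type u} [Field F] [CharZero F] (f : S ⟶ Spec (.of F))
    (hn : n ≠ 0) {d : ℕ} (hKd : ∀ σ : K, (σ : A.Sections) ^ d = 1) (hd : Odd d)
    (hsurj : ∀ ⦃Ω : Type u⦄ [Field Ω] [IsAlgClosed Ω] (s : Spec (.of Ω) ⟶ S) (y : D.hat.FibrePoints s),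
      ∃ x : A.FibrePoints s, x ≫ pol.lam = y) :
    ∃ polB : (A.quotientBy u K hcov hG hsm hgc).Polarization
        (A.dualPairOfQuotientRigidified u K hK hcov hG hsm hgc D hfree K' hcov' hG' hsm' hgc' hfree' Φ h4),
      polB.lam = A.polarizationDesc u K hcov D.hat K' hcov' pol.lam hlam := by
  letI : GrpObj (A.quotientOver u K) := (A.quotientBy u K hcov hG hsm hgc).grpObj
  letI : GrpObj (D.hat.quotientOver u K') := (D.hat.quotientBy u K' hcov' hG' hsm' hgc').grpObj
  haveI := pol.isMonHom
  haveI hlamB := A.isMonHom_polarizationDesc u K hcov hG hsm hgc hfree D.hat K' hcov' hG' hsm' hgc' pol.lam hlam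
  exact ⟨{ lam := A.polarizationDesc u K hcov D.hat K' hcov' pol.lam hlam
           isMonHom := hlamB
           exists_ample := fun Ω _ _ s =>
             A.exists_isAmple_isLambdaOfAt_polarizationDesc u K hK hcov hG hsm hgc D hfree K' hcov' hG' hsm' hgc' hfree' Φ h4
               pol hlam hKd hd s (natCast_ne_zero_of_charZero_base f s hn)
               (by exact_mod_cast (natCast_ne_zero_of_charZero_base f s (m := 2) two_ne_zero : ((2 : ℕ) : Ω) ≠ 0))
               (hsurj s) }, rfl⟩

include hfree hfree' in
/-- **(W2″) The Hecke instance `d := n` odd** over a base of characteristic zero (`n = d = N′/N`, socket (B) v8 `hodd`).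
[cite: MumfordFogartyKirwan1994, Ch. 6 §2 Definition 6.3 (p. 120) and Ch. 7 §3 (p. 139)] [cite: MumfordAV1970, §23 Thm. 2 (p. 231)] -/
theorem exists_polarization_lam_eq_polarizationDesc_of_charZero_of_odd {F : Type u} [Field F] [CharZero F]
    (f : S ⟶ Spec (.of F)) (hodd : Odd n)
    (hsurj : ∀ ⦃Ω : Type u⦄ [Field Ω] [IsAlgClosed Ω] (s : Spec (.of Ω) ⟶ S) (y : D.hat.FibrePoints s),
      ∃ x : A.FibrePoints s, x ≫ pol.lam = y) :
    ∃ polB : (A.quotientBy u K hcov hG hsm hgc).Polarization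
        (A.dualPairOfQuotientRigidified u K hK hcov hG hsm hgc D hfree K' hcov' hG' hsm' hgc' hfree' Φ h4),
      polB.lam = A.polarizationDesc u K hcov D.hat K' hcov' pol.lam hlam :=
  A.exists_polarization_lam_eq_polarizationDesc_of_charZero u K hK hcov hG hsm hgc D hfree K' hcov' hG' hsm' hgc' hfree' Φ h4
    pol hlam f (by rintro rfl; exact Nat.not_odd_zero hodd) hK hodd hsurj

end AbelianSchemeOver

end Literature.AlgebraicGeometry.AbelianSchemes

end
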